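import Literature.Probability.RandomPlanarGeometry.BackwardLoewnerReversal
import Literature.Probability.RandomPlanarGeometry.RohdeSchrammCor35Canonical
import Literature.Probability.RandomPlanarGeometry.SLEScaleInvariance
import Literature.Probability.RandomPlanarGeometry.SLELawOfDrivingProcess
import Literature.Probability.RandomPlanarGeometry.SLETraceContinuity
import HarnessLib

/-!
# Rohde–Schramm's Corollary 3.5, proved (`RohdeSchramm2005_cor35_holds`)

Trunk T-STOCH. Discharge of the named fact
`Literature.Probability.RandomPlanarGeometry.RohdeSchramm2005_cor35` (`SLEDerivativeEstimates.lean`;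
Rohde–Schramm, *Basic properties of SLE*, Ann. Math. 161 (2005), Cor. 3.5, p. 894) for **every**
probability space carrying a Brownian motion with continuous paths. After `BackwardLoewnerFlow`
(backward flow calculus), `BackwardLoewnerReversal` (Lemma 3.1 pathwise: `f̂ₜ' = hₜ'` for the
reversed recentred driver), `BackwardSLEFlow`/`BackwardSLEMartingale` (Thm. 3.2 as a supermartingale
inequality) and `RohdeSchrammCor35Canonical` (Cor. 3.5 for the backward flow of the canonical
Brownian motion), what remains is the **transfer in law** of Lemma 3.1 ("has the same distribution
as", p. 889):

* `Loewner.bwdDerivFun t z` — a functional of the driving path, measurable for the product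
  σ-algebra on `ℝ≥0 → ℝ`, equal to `|hₜ'(z)|` on every continuous path (Bernstein approximation of
  the backward flow through finitely many path values, `Loewner.measurable_loewnerInv`, iterated
  `limUnder`s; the derivative as a limit of difference quotients) and depending on the path only
  through its values on `[0, t]`;
* `exists_modification_measurable` — a process with a.e.-measurable marginals and continuous paths
  agrees, off one null set, with a process with measurable marginals (dyadic times);
* `isPreBrownianReal_reverse` — for a pre-Brownian motion `B` with measurable marginals and a fixed
  `t`, the reversed process `R s = B(t - s) + B(s ∨ t) - 2B(t)` (`= B(t-s) - B(t)` for `s ≤ t`,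
  continued by the increments of `B` after `t`) is a pre-Brownian motion (a Gaussian process with
  covariance `s ∧ u`, Mathlib `IsGaussianProcess.isPreBrownianReal_of_covariance`); hence the law of
  `√κ R` on path space is the law of the SLE_κ driving function on the canonical space
  (`map_eq_map_sleDriving_of_isPreBrownianReal`);
* `RohdeSchramm2005_cor35_holds` — the assembly: `P[|f̂ₜ'(x+iy)| ≥ δ/y] = P'[|hₜ'(x+iy)| ≥ δ/y] ≤ …`;
* the consequences recorded in the tree: `RohdeSchramm2005_thm36_holds` (Thm. 3.6),
  **`hasSLETrace_of_ne_eight_holds`** (Thm. 5.1: SLE_κ, `κ ≠ 8`, is generated by a curve) and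
  `HasSLETrace κ` for every `κ ≠ 8`.

## References

* S. Rohde, O. Schramm, *Basic properties of SLE*, Ann. of Math. 161 (2005), Lemma 3.1, Thm. 3.2,
  Cor. 3.5, Thm. 3.6, Thm. 5.1.
* D. Revuz, M. Yor, *Continuous Martingales and Brownian Motion* (1999), Ch. I §1 (Gaussian
  characterisation of Brownian motion; time reversal, Ex. (1.11)).
-/

noncomputable section

open Set Filter MeasureTheory Complex ProbabilityTheory
open _root_.Topology
open scoped NNReal ENNReal

namespace Literature.Probability.RandomPlanarGeometry

open Loewner Literature.Probability.Process RohdeSchramm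

/-! ### A measurable functional of the path equal to `|hₜ'(z)|` on continuous paths -/

namespace Loewner

variable {z : ℂ}

/-- For a continuous driving function, the inverse Loewner map at the Bernstein drivers of `V`
converges to the inverse Loewner map of `V` (stability `norm_loewnerInv_sub_loewnerInv_le_of_driving`
and Mathlib `bernsteinApproximation_uniform`; the argument of `measurable_loewnerInv`). [folklore] -/
theorem tendsto_loewnerInv_bernDriverFun {V : ℝ≥0 → ℝ} (hV : Continuous V) (t : ℝ≥0) (hz : 0 < z.im) :
    Tendsto (fun N : ℕ ↦ loewnerInv (bernDriverFun N t (bernNodes N t V)) t z) atTop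
      (𝓝 (loewnerInv V t z)) := by
  rw [tendsto_iff_norm_sub_tendsto_zero]
  have hbern := bernsteinApproximation_uniform (rescaleDriver V hV t)
  rw [tendsto_iff_norm_sub_tendsto_zero] at hbern
  refine squeeze_zero (fun N ↦ norm_nonneg _) (fun N ↦ norm_loewnerInv_sub_loewnerInv_le_of_driving
    (continuous_bernDriverFun N t _) hV t hz le_rfl
    fun u hu ↦ abs_bernDriverFun_bernNodes_sub_le hV N t hu) ?_
  simpa using hbern.const_mul (Real.exp (8 / z.im ^ 2 * t))

/-- **The backward flow as a measurable functional of the reversed path**: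
`bwdFlowFunRev t z V = lim_N f_t^{B_N V}(z)`, measurable in `V : ℝ≥0 → ℝ` (product σ-algebra) and
equal to `fₜ^V(z)` for continuous `V`. [cite: RohdeSchramm2005, §3 p. 896] -/
def bwdFlowFunRev (t : ℝ≥0) (z : ℂ) (V : ℝ≥0 → ℝ) : ℂ :=
  limUnder atTop fun N : ℕ ↦ loewnerInv (bernDriverFun N t (bernNodes N t V)) t z

/-- `bwdFlowFunRev t z` is measurable. [folklore] -/
theorem measurable_bwdFlowFunRev (t : ℝ≥0) (hz : 0 < z.im) : Measurable (bwdFlowFunRev t z) :=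
  (MeasureTheory.StronglyMeasurable.limUnder (l := atTop) fun N ↦
    ((continuous_loewnerInv_bernDriverFun N t hz).measurable.comp
      (measurable_bernNodes N t)).stronglyMeasurable).measurable

/-- On continuous paths `bwdFlowFunRev t z V = fₜ^V(z)`. [folklore] -/
theorem bwdFlowFunRev_eq {V : ℝ≥0 → ℝ} (hV : Continuous V) (t : ℝ≥0) (hz : 0 < z.im) :
    bwdFlowFunRev t z V = loewnerInv V t z :=
  (tendsto_loewnerInv_bernDriverFun hV t hz).limUnder_eq

/-- The reversal map `U ↦ U(t - ·)` of the path space is measurable. [folklore] -/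
theorem measurable_revDriver (t : ℝ≥0) : Measurable fun U : ℝ≥0 → ℝ ↦ revDriver U t :=
  measurable_pi_lambda _ fun s ↦ measurable_pi_apply (t - s)

/-- **`|hₜ'(z)|` as a measurable functional of the reversed path** `V = U(t - ·)`: the norm of
the limit of the difference quotients `(n+1)(fₜ^V(z + 1/(n+1)) - fₜ^V(z))` of the measurable backward
flow functional. [cite: RohdeSchramm2005, §3 p. 896] -/
def bwdDerivFunRev (t : ℝ≥0) (z : ℂ) (V : ℝ≥0 → ℝ) : ℝ :=
  ‖limUnder atTop fun n : ℕ ↦ ((n : ℂ) + 1) *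
    (bwdFlowFunRev t (z + ((1 : ℝ) / ((n : ℝ) + 1) : ℝ)) V - bwdFlowFunRev t z V)‖

/-- **`|hₜ'(z)|` as a measurable functional of the driving path** (through its reversal at `t`, so
that it only depends on the path on `[0, t]`). [cite: RohdeSchramm2005, §3 p. 896] -/
def bwdDerivFun (t : ℝ≥0) (z : ℂ) (U : ℝ≥0 → ℝ) : ℝ := bwdDerivFunRev t z (revDriver U t)

/-- `bwdDerivFunRev t z` is measurable. [folklore] -/
theorem measurable_bwdDerivFunRev (t : ℝ≥0) (hz : 0 < z.im) : Measurable (bwdDerivFunRev t z) := by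
  have hz' : ∀ n : ℕ, 0 < (z + ((1 : ℝ) / ((n : ℝ) + 1) : ℝ)).im := fun n ↦ by simpa using hz
  refine (MeasureTheory.StronglyMeasurable.limUnder (l := atTop) fun n ↦ ?_).measurable.norm
  exact (measurable_const.mul ((measurable_bwdFlowFunRev t (hz' n)).sub
    (measurable_bwdFlowFunRev t hz))).stronglyMeasurable

/-- `bwdDerivFun t z` is measurable. [folklore] -/
theorem measurable_bwdDerivFun (t : ℝ≥0) (hz : 0 < z.im) : Measurable (bwdDerivFun t z) :=
  (measurable_bwdDerivFunRev t hz).comp (measurable_revDriver t)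

/-- `bwdDerivFun` only depends on the reversed path: paths with the same reversal at `t` (i.e.
agreeing on `[0, t]`) have the same value. [folklore] -/
theorem bwdDerivFun_congr {t : ℝ≥0} {z : ℂ} {U U' : ℝ≥0 → ℝ} (h : revDriver U t = revDriver U' t) :
    bwdDerivFun t z U = bwdDerivFun t z U' := by
  rw [bwdDerivFun, bwdDerivFun, h]

/-- **On continuous paths `bwdDerivFun t z U = |hₜ'(z)|`**, the start-derivative of the backward flow
(`hasDerivAt_bwdFlow_start`; the difference quotients along `1/(n+1)` converge to the derivative).
[cite: RohdeSchramm2005, eq. (3.9)] -/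
theorem bwdDerivFun_eq {U : ℝ≥0 → ℝ} (hU : Continuous U) (t : ℝ≥0) (hz : 0 < z.im) :
    bwdDerivFun t z U = ‖deriv (fun w ↦ bwdFlow U w t) z‖ := by
  have hV : Continuous (revDriver U t) := continuous_revDriver hU t
  have hz' : ∀ n : ℕ, 0 < (z + ((1 : ℝ) / ((n : ℝ) + 1) : ℝ)).im := fun n ↦ by simpa using hz
  -- the difference quotients of `w ↦ hₜ(w)` along `1/(n+1)`
  set f : ℂ → ℂ := fun w ↦ bwdFlow U w t with hf
  have hquot : ∀ n : ℕ, ((n : ℂ) + 1) *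
      (bwdFlowFunRev t (z + ((1 : ℝ) / ((n : ℝ) + 1) : ℝ)) (revDriver U t) - bwdFlowFunRev t z (revDriver U t)) =
      slope f z (z + ((1 : ℝ) / ((n : ℝ) + 1) : ℝ)) := by
    intro n
    rw [bwdFlowFunRev_eq hV t (hz' n), bwdFlowFunRev_eq hV t hz, slope_def_field]
    simp only [hf, bwdFlow_apply, add_sub_cancel_left]
    have hn : ((((1 : ℝ) / ((n : ℝ) + 1) : ℝ)) : ℂ) ≠ 0 := by
      rw [Complex.ofReal_ne_zero]; positivity
    rw [eq_div_iff hn]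
    push_cast
    field_simp
  have hderiv := hasDerivAt_bwdFlow_start hU t hz
  have hslope := (hasDerivAt_iff_tendsto_slope.1 hderiv)
  -- the sequence `z + 1/(n+1)` tends to `z` within `{z}ᶜ`
  have hseq : Tendsto (fun n : ℕ ↦ z + ((1 : ℝ) / ((n : ℝ) + 1) : ℝ)) atTop (𝓝[≠] z) := by
    refine tendsto_nhdsWithin_of_tendsto_nhds_of_eventually_within _ ?_ (Eventually.of_forall fun n ↦ ?_)
    · have h1 : Tendsto (fun n : ℕ ↦ ((1 : ℝ) / ((n : ℝ) + 1))) atTop (𝓝 0) :=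
        tendsto_one_div_add_atTop_nhds_zero_nat
      have h2 : Tendsto (fun n : ℕ ↦ (((1 : ℝ) / ((n : ℝ) + 1) : ℝ) : ℂ)) atTop (𝓝 ((0 : ℝ) : ℂ)) :=
        (Complex.continuous_ofReal.tendsto 0).comp h1
      simpa using (tendsto_const_nhds (x := z)).add h2
    · rw [mem_compl_singleton_iff, Ne, add_eq_left, Complex.ofReal_eq_zero]
      positivity
  have hlim : Tendsto (fun n : ℕ ↦ ((n : ℂ) + 1) *
      (bwdFlowFunRev t (z + ((1 : ℝ) / ((n : ℝ) + 1) : ℝ)) (revDriver U t) - bwdFlowFunRev t z (revDriver U t)))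
      atTop (𝓝 (deriv f z)) := by
    simp only [hquot]
    rw [hderiv.deriv]
    exact hslope.comp hseq
  rw [bwdDerivFun, bwdDerivFunRev, hlim.limUnder_eq]

end Loewner

/-! ### A measurable modification of a process with continuous paths -/

section Modification

variable {Ω : Type*} [MeasurableSpace Ω] {P : Measure Ω} {X : ℝ≥0 → Ω → ℝ}

/-- **A process with a.e.-measurable marginals and continuous paths agrees, off one null set, with a
process with measurable marginals** (and still continuous paths): modify the process to `0` on a
null set `N` off which all its dyadic marginals coincide with measurable versions; every marginal of
the modification is then an everywhere limit of measurable functions (path continuity along dyadic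
approximations). [folklore] -/
theorem exists_modification_measurable (hX : ∀ t, AEMeasurable (X t) P) (hc : ∀ ω, Continuous (X · ω)) :
    ∃ N : Set Ω, MeasurableSet N ∧ P N = 0 ∧ ∀ t, Measurable (Nᶜ.indicator (X t)) := by
  classical
  -- dyadic times and measurable versions there
  set τ : ℕ × ℕ → ℝ≥0 := fun p ↦ ((p.2 : ℕ) : ℝ≥0) / 2 ^ p.1 with hτ
  set g : ℕ × ℕ → Ω → ℝ := fun p ↦ (hX (τ p)).mk (X (τ p)) with hg
  have hgm : ∀ p, Measurable (g p) := fun p ↦ (hX (τ p)).measurable_mk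
  have hgae : ∀ p, X (τ p) =ᵐ[P] g p := fun p ↦ (hX (τ p)).ae_eq_mk
  -- the null set
  have hnull : P {ω | ∃ p, X (τ p) ω ≠ g p ω} = 0 := by
    have : {ω | ∃ p, X (τ p) ω ≠ g p ω} = ⋃ p, {ω | X (τ p) ω ≠ g p ω} := by
      ext ω; simp
    rw [this, measure_iUnion_null_iff]
    intro p
    exact hgae p
  obtain ⟨N, hsubN, hNm, hN0⟩ := exists_measurable_superset_of_null hnull
  refine ⟨N, hNm, hN0, fun t ↦ ?_⟩
  have hoff : ∀ ω, ω ∉ N → ∀ p, X (τ p) ω = g p ω := fun ω hω p ↦ by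
    by_contra h
    exact hω (hsubN ⟨p, h⟩)
  -- dyadic approximation of `t`
  set f : ℕ → Ω → ℝ := fun n ↦ Nᶜ.indicator (g (n, ⌊(t : ℝ) * 2 ^ n⌋₊)) with hf
  have hfm : ∀ n, Measurable (f n) := fun n ↦ (hgm _).indicator hNm.compl
  refine measurable_of_tendsto_metrizable hfm (tendsto_pi_nhds.2 fun ω ↦ ?_)
  by_cases hω : ω ∈ N
  · have hωc : ω ∉ Nᶜ := fun h ↦ h hω
    have h0 : ∀ n, f n ω = 0 := fun n ↦ Set.indicator_of_notMem hωc _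
    simp only [h0, Set.indicator_of_notMem hωc]
    exact tendsto_const_nhds
  · have hωc : ω ∈ Nᶜ := hω
    have heq : ∀ n, f n ω = X (Literature.Analysis.FunctionSpaces.dyadicFloor n t) ω := fun n ↦ by
      simp only [hf, Set.indicator_of_mem hωc]
      rw [← hoff ω hω]
      rfl
    simp only [heq, Set.indicator_of_mem hωc]
    exact ((hc ω).tendsto t).comp (Literature.Analysis.FunctionSpaces.tendsto_dyadicFloor t)

end Modification

/-! ### Time reversal of a Brownian motion at a fixed time -/

section Reverse

variable {Ω : Type*} {B : ℝ≥0 → Ω → ℝ}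

/-- **The Brownian motion reversed at time `t`**, continued by the increments of `B` after `t`:
`R s = B(t - s) + B(s ∨ t) - 2B(t)`, i.e. `R s = B(t - s) - B(t)` for `s ≤ t` and
`R s = B(0) + B(s) - 2B(t)` for `s ≥ t` (Rohde–Schramm's `ξ̂_{t₁}(t) = ξ(t₁ + t) - ξ(t₁)`, `t ≤ 0`,
extended to positive times). [cite: RohdeSchramm2005, Lemma 3.1] -/
def reverseAt (B : ℝ≥0 → Ω → ℝ) (t : ℝ≥0) (s : ℝ≥0) (ω : Ω) : ℝ :=
  B (t - s) ω + B (max s t) ω - 2 * B t ω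

/-- Unfolding of `reverseAt`. [folklore] -/
theorem reverseAt_apply (B : ℝ≥0 → Ω → ℝ) (t s : ℝ≥0) (ω : Ω) :
    reverseAt B t s ω = B (t - s) ω + B (max s t) ω - 2 * B t ω := rfl

/-- For `s ≤ t`: `R s = B(t - s) - B(t)`. [folklore] -/
theorem reverseAt_of_le {t s : ℝ≥0} (hst : s ≤ t) (ω : Ω) : reverseAt B t s ω = B (t - s) ω - B t ω := by
  rw [reverseAt_apply, max_eq_right hst]; ring

/-- The reversed process has continuous paths when `B` has. [folklore] -/
theorem continuous_reverseAt (hBc : ∀ ω, Continuous (B · ω)) (t : ℝ≥0) (ω : Ω) :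
    Continuous fun s ↦ reverseAt B t s ω :=
  (((hBc ω).comp (continuous_const.sub continuous_id)).add
    ((hBc ω).comp (continuous_id.max continuous_const))).sub continuous_const

/-- The reversed process starts at `0`. [folklore] -/
theorem reverseAt_zero (t : ℝ≥0) (ω : Ω) : reverseAt B t 0 ω = 0 := by
  rw [reverseAt_of_le (show (0 : ℝ≥0) ≤ t from bot_le), tsub_zero, sub_self]

/-- The reversed process read backwards from `t` is the recentred original path:
`R(t - r) = B(t - (t - r)) - B(t)` (`= B(r) - B(t)` for `r ≤ t`, `0` for `r ≥ t`). [folklore] -/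
theorem reverseAt_tsub (t r : ℝ≥0) (ω : Ω) : reverseAt B t (t - r) ω = B (t - (t - r)) ω - B t ω :=
  reverseAt_of_le tsub_le_self ω

/-- The `min`-arithmetic of the covariance of the reversed process: for `s ≤ u`,
`(t-s)∧(t-u) + (t-s)∧(u∨t) - 2 (t-s)∧t + (s∨t)∧(t-u) + (s∨t)∧(u∨t) - 2 (s∨t)∧t
 - 2 t∧(t-u) - 2 t∧(u∨t) + 4 t∧t = s`. [folklore] -/
theorem reverseAt_min_algebra {s u : ℝ≥0} (t : ℝ≥0) (hsu : s ≤ u) :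
    ((min (t - s) (t - u) : ℝ≥0) : ℝ) + (min (t - s) (max u t) : ℝ≥0) - 2 * (min (t - s) t : ℝ≥0) +
      ((min (max s t) (t - u) : ℝ≥0) : ℝ) + (min (max s t) (max u t) : ℝ≥0) - 2 * (min (max s t) t : ℝ≥0) -
      2 * ((min t (t - u) : ℝ≥0) : ℝ) - 2 * (min t (max u t) : ℝ≥0) + 4 * (min t t : ℝ≥0) = s := by
  rcases le_total u t with hut | htu
  · -- `s ≤ u ≤ t`
    have hst : s ≤ t := hsu.trans hut
    have h1 : min (t - s) (t - u) = t - u := min_eq_right (tsub_le_tsub_left hsu t)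
    have h2 : min (t - s) (max u t) = t - s := by rw [max_eq_right hut]; exact min_eq_left tsub_le_self
    have h3 : min (t - s) t = t - s := min_eq_left tsub_le_self
    have h4 : min (max s t) (t - u) = t - u := by rw [max_eq_right hst]; exact min_eq_right tsub_le_self
    have h5 : min (max s t) (max u t) = t := by rw [max_eq_right hst, max_eq_right hut, min_self]
    have h6 : min (max s t) t = t := by rw [max_eq_right hst, min_self]
    have h7 : min t (t - u) = t - u := min_eq_right tsub_le_self
    have h8 : min t (max u t) = t := by rw [max_eq_right hut, min_self]
    rw [h1, h2, h3, h4, h5, h6, h7, h8, min_self, NNReal.coe_sub hut, NNReal.coe_sub hst]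
    ring
  · rcases le_total s t with hst | hts
    · -- `s ≤ t ≤ u`
      have htu0 : t - u = 0 := tsub_eq_zero_of_le htu
      have h1 : min (t - s) (t - u) = 0 := by rw [htu0, min_eq_right (show (0 : ℝ≥0) ≤ _ from bot_le)]
      have h2 : min (t - s) (max u t) = t - s := by
        rw [max_eq_left htu]; exact min_eq_left (tsub_le_self.trans htu)
      have h3 : min (t - s) t = t - s := min_eq_left tsub_le_self
      have h4 : min (max s t) (t - u) = 0 := by rw [htu0, min_eq_right (show (0 : ℝ≥0) ≤ _ from bot_le)]
      have h5 : min (max s t) (max u t) = t := by rw [max_eq_right hst, max_eq_left htu, min_eq_left htu]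
      have h6 : min (max s t) t = t := by rw [max_eq_right hst, min_self]
      have h7 : min t (t - u) = 0 := by rw [htu0, min_eq_right (show (0 : ℝ≥0) ≤ _ from bot_le)]
      have h8 : min t (max u t) = t := by rw [max_eq_left htu, min_eq_left htu]
      rw [h1, h2, h3, h4, h5, h6, h7, h8, min_self, NNReal.coe_sub hst]
      push_cast
      ring
    · -- `t ≤ s ≤ u`
      have htu0 : t - u = 0 := tsub_eq_zero_of_le htu
      have hts0 : t - s = 0 := tsub_eq_zero_of_le hts
      have h1 : min (t - s) (t - u) = 0 := by rw [htu0, hts0, min_self]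
      have h2 : min (t - s) (max u t) = 0 := by rw [hts0, min_eq_left (show (0 : ℝ≥0) ≤ _ from bot_le)]
      have h3 : min (t - s) t = 0 := by rw [hts0, min_eq_left (show (0 : ℝ≥0) ≤ _ from bot_le)]
      have h4 : min (max s t) (t - u) = 0 := by rw [htu0, min_eq_right (show (0 : ℝ≥0) ≤ _ from bot_le)]
      have h5 : min (max s t) (max u t) = s := by rw [max_eq_left hts, max_eq_left htu, min_eq_left hsu]
      have h6 : min (max s t) t = t := by rw [max_eq_left hts, min_eq_right hts]
      have h7 : min t (t - u) = 0 := by rw [htu0, min_eq_right (show (0 : ℝ≥0) ≤ _ from bot_le)]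
      have h8 : min t (max u t) = t := by rw [max_eq_left htu, min_eq_left htu]
      rw [h1, h2, h3, h4, h5, h6, h7, h8, min_self]
      push_cast
      ring

variable [MeasurableSpace Ω] {P : Measure Ω}

/-- The marginals of the reversed process are measurable when those of `B` are. [folklore] -/
theorem measurable_reverseAt (hBm : ∀ t, Measurable (B t)) (t s : ℝ≥0) : Measurable (reverseAt B t s) :=
  ((hBm _).add (hBm _)).sub ((hBm _).const_mul 2)

/-- The reversed process is a Gaussian process (each marginal is a linear combination of three
marginals of `B`; Mathlib `IsGaussianProcess.of_isGaussianProcess`). [folklore] -/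
theorem isGaussianProcess_reverseAt (hB : IsGaussianProcess B P) (t : ℝ≥0) :
    IsGaussianProcess (reverseAt B t) P := by
  classical
  refine hB.of_isGaussianProcess fun s ↦ ⟨{t - s, max s t, t}, ?_, ?_⟩
  · exact ContinuousLinearMap.proj (R := ℝ) (φ := fun _ : ({t - s, max s t, t} : Finset ℝ≥0) ↦ ℝ)
        ⟨t - s, by simp⟩ +
      ContinuousLinearMap.proj (R := ℝ) (φ := fun _ : ({t - s, max s t, t} : Finset ℝ≥0) ↦ ℝ)
        ⟨max s t, by simp⟩ -
      (2 : ℝ) • ContinuousLinearMap.proj (R := ℝ) (φ := fun _ : ({t - s, max s t, t} : Finset ℝ≥0) ↦ ℝ)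
        ⟨t, by simp⟩
  · intro ω
    simp [reverseAt_apply, Finset.restrict_def, smul_eq_mul]

/-- The reversed process is centred. [folklore] -/
theorem integral_reverseAt (hB : IsPreBrownianReal B P) (t s : ℝ≥0) : P[reverseAt B t s] = 0 := by
  have hi : ∀ r, Integrable (B r) P := fun r ↦ hB.integrable_eval r
  have h12 : Integrable (fun ω ↦ B (t - s) ω + B (max s t) ω) P := (hi _).add (hi _)
  have h3 : Integrable (fun ω ↦ 2 * B t ω) P := (hi _).const_mul 2
  simp_rw [reverseAt_apply]
  rw [integral_sub h12 h3, integral_add (hi _) (hi _), integral_const_mul]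
  simp [hB.integral_eval]

/-- The covariance of the reversed process is `s ∧ u`. [folklore] -/
theorem covariance_reverseAt (hB : IsPreBrownianReal B P) (t : ℝ≥0) {s u : ℝ≥0} (hsu : s ≤ u) :
    cov[reverseAt B t s, reverseAt B t u; P] = s := by
  haveI := hB.isGaussianProcess.isProbabilityMeasure
  have hm : ∀ r, MemLp (B r) 2 P := fun r ↦ (hB.isGaussianProcess.hasGaussianLaw_eval r).memLp_two
  have hm2 : ∀ r, MemLp (fun ω ↦ 2 * B r ω) 2 P := fun r ↦ (hm r).const_mul 2
  have hcov : ∀ a c : ℝ≥0, cov[B a, B c; P] = ((min a c : ℝ≥0) : ℝ) := fun a c ↦ hB.covariance_fun_eval a c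
  have hR : ∀ r, reverseAt B t r = (B (t - r) + B (max r t)) - fun ω ↦ 2 * B t ω := fun r ↦ by
    funext ω; simp [reverseAt_apply]
  -- expand the right argument
  have hright : ∀ {Xl : Ω → ℝ}, MemLp Xl 2 P → ∀ r,
      cov[Xl, reverseAt B t r; P] = cov[Xl, B (t - r); P] + cov[Xl, B (max r t); P] - 2 * cov[Xl, B t; P] := by
    intro Xl hXl r
    rw [hR r, covariance_sub_right hXl ((hm _).add (hm _)) (hm2 _), covariance_add_right hXl (hm _) (hm _),
      covariance_const_mul_right]
  -- expand the left argument
  have hleft : ∀ {Y : Ω → ℝ}, MemLp Y 2 P →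
      cov[reverseAt B t s, Y; P] = cov[B (t - s), Y; P] + cov[B (max s t), Y; P] - 2 * cov[B t, Y; P] := by
    intro Y hY
    rw [hR s, covariance_sub_left ((hm _).add (hm _)) (hm2 _) hY, covariance_add_left (hm _) (hm _) hY,
      covariance_const_mul_left]
  have hmR : MemLp (reverseAt B t u) 2 P := by
    rw [hR u]; exact ((hm _).add (hm _)).sub (hm2 _)
  rw [hleft hmR, hright (hm _), hright (hm _), hright (hm _)]
  simp only [hcov]
  have := reverseAt_min_algebra t hsu
  linarith

/-- **The reversed process is a pre-Brownian motion** (a centred Gaussian process with covariance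
`s ∧ u`; Mathlib `IsGaussianProcess.isPreBrownianReal_of_covariance`). Rohde–Schramm (2005), proof
of Lemma 3.1 ("`ξ̂_{t₁}` has the same law as `ξ`"); Revuz–Yor (1999), Ch. I, Ex. (1.11) (time
reversal). [cite: RohdeSchramm2005, Lemma 3.1] -/
theorem isPreBrownianReal_reverseAt (hB : IsPreBrownianReal B P) (t : ℝ≥0) :
    IsPreBrownianReal (reverseAt B t) P :=
  (isGaussianProcess_reverseAt hB.isGaussianProcess t).isPreBrownianReal_of_covariance
    (integral_reverseAt hB t) fun _ _ hsu ↦ covariance_reverseAt hB t hsu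

end Reverse


/-! ### Corollary 3.5, proved -/

section Assembly

/-- Sets which agree almost everywhere have the same measure, membership form. [folklore] -/
theorem measure_congr_of_ae_iff {α : Type*} [MeasurableSpace α] {μ : Measure α} {s t : Set α}
    (h : ∀ᵐ x ∂μ, x ∈ s ↔ x ∈ t) : μ s = μ t :=
  measure_congr (Filter.eventuallyEq_set.2 h)

/-- **Rohde–Schramm (2005), Corollary 3.5, holds** on every probability space: for `κ > 0` and
`b ∈ [0, 1 + 4/κ]` there is `C = cor35Const κ b` such that for every Brownian motion `B` with
continuous paths, all `t ≤ 1`, `y, δ ∈ (0, 1]`, `x ∈ ℝ`: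
`P[|f̂ₜ'(x + iy)| ≥ δ/y] ≤ C (1 + x²/y²)^b (y/δ)^λ ϑ(δ, a - λ)`.
Proof: by Lemma 3.1 pathwise (`Loewner.deriv_fHat_eq_deriv_bwdFlow`) the event is, off a null set,
the event that the measurable functional `Loewner.bwdDerivFun t z` of the reversed driver
`√κ R`, `R = reverseAt B' t` (`B'` a measurable modification of `B`), is `≥ δ/y`; `√κ R` has the
path law of the canonical SLE_κ driving function (`isPreBrownianReal_reverseAt`,
`map_eq_map_sleDriving_of_isPreBrownianReal`), under which the functional is `|hₜ'(z)|` for the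
canonical backward flow, estimated in `measure_le_norm_deriv_bwdFlow_le` (Thm. 3.2 + the printed
proof of Cor. 3.5). [cite: RohdeSchramm2005, Cor 3.5] -/
theorem RohdeSchramm2005_cor35_holds :
    ∀ {Ω : Type*} [MeasurableSpace Ω] (P : Measure Ω), RohdeSchramm2005_cor35 P := by
  intro Ω _ P κ hκ b hb0 hb1
  refine ⟨cor35Const κ b, fun B hB hBc t ht x y δ hy0 hy1 hδ0 hδ1 ↦ ?_⟩
  -- the point `z = x + iy`
  set z : ℂ := (x : ℂ) + I * (y : ℂ) with hzdef
  have hzim : z.im = y := by simp [hzdef]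
  have hzre : z.re = x := by simp [hzdef]
  have hz : 0 < z.im := by rw [hzim]; exact hy0
  -- a measurable modification `B'` of `B`
  obtain ⟨N, hNm, hN0, hmeas⟩ := exists_modification_measurable
    (fun s ↦ hB.toIsPreBrownianReal.aemeasurable s) hBc (P := P)
  set B' : ℝ≥0 → Ω → ℝ := fun s ↦ Nᶜ.indicator (B s) with hB'def
  have hNae : ∀ᵐ ω ∂P, ω ∉ N := measure_eq_zero_iff_ae_notMem.1 hN0
  have hB'eq : ∀ ω, ω ∉ N → ∀ s, B' s ω = B s ω := fun ω hω s ↦ Set.indicator_of_mem (show ω ∈ Nᶜ from hω) _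
  have hB' : IsPreBrownianReal B' P := by
    refine hB.toIsPreBrownianReal.congr fun s ↦ ?_
    filter_upwards [hNae] with ω hω
    exact (hB'eq ω hω s).symm
  have hB'm : ∀ s, Measurable (B' s) := hmeas
  -- the reversed process and its path law
  set R : ℝ≥0 → Ω → ℝ := reverseAt B' t with hRdef
  have hR : IsPreBrownianReal R P := isPreBrownianReal_reverseAt hB' t
  have hRm : ∀ s, Measurable (R s) := measurable_reverseAt hB'm t
  set Φ : Ω → ℝ≥0 → ℝ := fun ω s ↦ Real.sqrt κ * R s ω with hΦdef
  have hΦm : Measurable Φ := measurable_pi_lambda _ fun s ↦ (hRm s).const_mul _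
  have hlaw : P.map Φ = Process.preWienerMeasure.map (sleDriving κ) :=
    map_eq_map_sleDriving_of_isPreBrownianReal hR hRm κ
  -- the measurable path-space event
  set S : Set (ℝ≥0 → ℝ) := {U | δ / y ≤ bwdDerivFun t z U} with hSdef
  have hS : MeasurableSet S := measurableSet_le measurable_const (measurable_bwdDerivFun t hz)
  -- a.e. identification of the event with `Φ ⁻¹' S`
  have hident : ∀ᵐ ω ∂P,
      ω ∈ {ω | δ / y ≤ ‖deriv (fHat (fun s ↦ Real.sqrt κ * B s ω) t) ((x : ℂ) + I * (y : ℂ))‖} ↔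
        ω ∈ Φ ⁻¹' S := by
    filter_upwards [hNae] with ω hω
    set W : ℝ≥0 → ℝ := fun s ↦ Real.sqrt κ * B s ω with hWdef
    have hW : Continuous W := continuous_const.mul (hBc ω)
    have hrev : revDriver (revCentredDriver W t) t = revDriver (Φ ω) t := by
      funext r
      simp only [revDriver_apply, revCentredDriver_apply, hΦdef, hRdef, hWdef]
      rw [reverseAt_tsub, hB'eq ω hω, hB'eq ω hω]
      ring
    have hval : ‖deriv (fHat W t) z‖ = bwdDerivFun t z (Φ ω) := by
      rw [deriv_fHat_eq_deriv_bwdFlow hW t hz, ← bwdDerivFun_eq (continuous_revCentredDriver hW t) t hz,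
        bwdDerivFun_congr hrev]
    rw [Set.mem_preimage, hSdef, Set.mem_setOf_eq]
    change δ / y ≤ ‖deriv (fHat W t) z‖ ↔ δ / y ≤ bwdDerivFun t z (Φ ω)
    rw [hval]
  -- transport to the canonical space
  have hSet : (sleDriving κ) ⁻¹' S = {ω' | δ / y ≤ ‖deriv (fun w ↦ bwdFlow (sleDriving κ ω') w t) z‖} := by
    ext ω'
    rw [Set.mem_preimage, hSdef, Set.mem_setOf_eq, Set.mem_setOf_eq,
      bwdDerivFun_eq (continuous_sleDriving κ ω') t hz]
  have hcanon : Process.preWienerMeasure ((sleDriving κ) ⁻¹' S) =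
      Process.preWienerMeasure {ω' | δ / y ≤ ‖deriv (fun w ↦ bwdFlow (sleDriving κ ω') w t) z‖} := by
    rw [hSet]
  have ht' : ((t : ℝ≥0) : ℝ) ≤ 1 := by exact_mod_cast ht
  have hbound := measure_le_norm_deriv_bwdFlow_le hκ hb0 hb1 hz (by rw [hzim]; exact hy1) ht' hδ0 hδ1
    (κ := κ) (w := z)
  rw [hzim, hzre] at hbound
  calc P {ω | δ / y ≤ ‖deriv (fHat (fun s ↦ Real.sqrt κ * B s ω) t) ((x : ℂ) + I * (y : ℂ))‖}
      = P (Φ ⁻¹' S) := measure_congr_of_ae_iff hident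
    _ = P.map Φ S := (Measure.map_apply hΦm hS).symm
    _ = Process.preWienerMeasure.map (sleDriving κ) S := by rw [hlaw]
    _ = Process.preWienerMeasure ((sleDriving κ) ⁻¹' S) := Measure.map_apply (measurable_sleDriving_pi κ) hS
    _ = Process.preWienerMeasure {ω' | δ / y ≤ ‖deriv (fun w ↦ bwdFlow (sleDriving κ ω') w t) z‖} := hcanon
    _ ≤ _ := hbound

/-- **Rohde–Schramm (2005), Theorem 3.6, holds**: for `κ > 0`, `κ ≠ 8`, almost surely
`H(y, t) = f̂ₜ(iy)` extends continuously to `[0, ∞) × [0, ∞)` (`RohdeSchramm2005_thm36_of_cor35` and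
Cor. 3.5). [cite: RohdeSchramm2005, Thm 3.6] -/
theorem RohdeSchramm2005_thm36_holds : RohdeSchramm2005_thm36 :=
  RohdeSchramm2005_thm36_of_cor35 (RohdeSchramm2005_cor35_holds _)

/-- **The Rohde–Schramm trace theorem holds: SLE_κ is generated by a curve for every `κ ≠ 8`**
(Rohde–Schramm (2005), Thm. 5.1; the named fact `hasSLETrace_of_ne_eight` of `SLE.lean`).
Thm. 3.6 (from Cor. 3.5, proved here, via `RohdeSchramm2005_thm36_of_cor35`), Thm. 4.1
(`RohdeSchramm2005_thm41_holds`) and the case `κ = 0` (`hasSLETrace_zero`), assembled in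
`hasSLETrace_of_ne_eight_of_cor35`. [cite: RohdeSchramm2005, Thm 5.1] -/
theorem hasSLETrace_of_ne_eight_holds : hasSLETrace_of_ne_eight :=
  hasSLETrace_of_ne_eight_of_cor35 (RohdeSchramm2005_cor35_holds _)

/-- `HasSLETrace κ` for every `κ ≠ 8`, unconditionally. [cite: RohdeSchramm2005, Thm 5.1] -/
theorem hasSLETrace_of_ne_eight_apply {κ : ℝ≥0} (hκ : κ ≠ 8) : HasSLETrace κ :=
  hasSLETrace_of_ne_eight_holds hκ

end Assembly


end Literature.Probability.RandomPlanarGeometry
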